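import Literature.AlgebraicGeometry.Motives.HodgeStructureFourierTransformWeylElement
import Literature.Algebra.Lie.LefschetzModuleSL2Representation
import HarnessLib

/-!
# Beauville's theorem on `H•(X) = ⋀W`: THE ACTION OF `SL₂(K)` — `(1 a ; 0 1)·z = e^{aθ} z`, `(1 0 ; a 1)·z = a^g e^{θ/a} ⋆ z`,
# `(0 −1 ; 1 0)·z = ℱ(z)`, `(n 0 ; 0 n⁻¹)·z = n^{−g} n^*z` (Beauville 2010, §4 Theorem)

[topic AlgebraicGeometry/Motives]

Layer `Literature/AlgebraicGeometry/Motives`, lane `lit-hodgefound` (Track 2 foundations library; prover seat `lit-hodgefound-p34`,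
generation 38, row g38-#2). ONE DEFINITION WITH BODY (`sl2Action ω g : SL(2, K) →* Module.End K (⋀W)`, the specialisation of row
g38-#1's abstract `HasLefschetzProperty.sl2Rep` to the Lefschetz module `(⋀W, h = k − g, L_ω = ω ∧ ·)`) and theorems; no named fact,
no instance, no notation (net debt `0`). Sequel of row g38-#1 (`Algebra/Lie/LefschetzModuleSL2Representation`: a finite-dimensional
Lefschetz module integrates to `ρ : SL(2, K) →* End M` with `ρ(1 a ; 0 1) = exp(a e)`, `ρ(1 0 ; a 1) = exp(a f)`, `ρ(0 −1 ; 1 0) = w`,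
`ρ(diag(t, t⁻¹)) = tʰ`, uniqueness), of rows g37-#2/#3 (`HodgeStructureWeylOperatorBeauvilleForm`, `HodgeStructureFourierTransformWeylElement`:
`exp(L) = e^ω ∧ ·`, `exp(Λ) x = x ⋆ e^ω`, **`ℱ = w`**), g36-#9 (`x ⋆ ω^{[m]} = Λ^{g−m} x/(g−m)!`), g36-#8 (`Λ x = x ⋆ ω^{g−1}/(g−1)!`) and g33-#4
(`⋀(n · id) = nᵏ` on `⋀ᵏW`).

THE SETTING. `K` a field of characteristic `0`; `ω ∈ ⋀²W` symplectic of genus `g ≥ 1` (`H•(X) = ⋀W`, `W = H¹(X, K)`, `dim X = g`, `θ = ω`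
a PRINCIPAL polarization: `τ(ω^g/g!) = 1`, so Beauville's degree `d = θ^g/g! = 1`); `L = L_ω = ω ∧ ·` (`LinearMap.mul K _ ω`), `Λ =
lefschetzDual ω g`, `h = k − g` on `⋀ᵏW` (`shiftedDegree`), `⋆ = hω.pontryagin` (the Pontryagin product, rows g35), `ℱ = fourierTransform ω g`
(`= (e^℘)_*`, row g37-#3), `n^* = ⋀(n · id)` (pull-back by the multiplication `n_X`), `e^{aθ} = Σ_{m≤g} (aω)^m/m!`.

## Source, VERBATIM (held text `paper:arxiv-0805.1541`, p0005)

A. Beauville, *The action of `SL₂` on abelian varieties*, J. Ramanujan Math. Soc. **25** (2010) [Beauville2010SL2], §4: "Recall that the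
Pontryagin product of two elements `α, β` of `CH(A)` is defined by `α ⋆ β := m_*(p^*α · q^*β)`. We will denote by `ℱ` the `ℚ`-linear
automorphism `d⁻¹(e^℘)_*` of `CH(A)`; this is the Fourier transform for Chow groups, see [B1] and [B2]. **Theorem** Let `A` be an abelian
variety, with a polarization `θ` of degree `d`. There is a representation of `SL₂` on `CH(A)`, which is a direct sum of finite-dimensional
representations, such that, for `n ∈ ℤ ∖ {0}`, `a ∈ ℚ`, `z ∈ CH(A)`: `(n 0 ; 0 n⁻¹)·z = n^{−g} n^*z`, `(0 −1 ; 1 0)·z = ℱ(z)`,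
`(1 a ; 0 1)·z = e^{aθ} z`, `(1 0 ; a 1)·z = d⁻¹ a^g e^{θ/a} ⋆ z`. The corresponding action of the Lie algebra `𝔰𝔩₂` is given by: `Xz = θz`,
`Yz = d⁻¹ (θ^{g−1}/(g−1)!) ⋆ z`, `Hz = (2p−g−s) z` for `z ∈ CH^p_s(A)`." Proof: "By definition, `g·z = φ(g)_* z` for `g ∈ SL₂`, `z ∈ CH(A)`.
Thus `(n 0 ; 0 n⁻¹)·z = n^{−g}(Γ_n)_* z = n^{−g} n^* z`, `(0 −1 ; 1 0)·z = d⁻¹(e^℘)_* z = ℱ(z)`, `(1 a ; 0 1)·z = (Δ_* e^{aθ})_* z = e^{aθ} z`,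
`(1 0 ; a 1)·z = d⁻¹ a^g (e^{δ^*θ/a})_* z` […] `(e^{δ^*θ/a})_* z = […] = e^{θ/a} ⋆ z`." §2 (p0003): "Recall that the group `SL₂(ℤ)` is generated
by the elements `w = (0 −1 ; 1 0)`, `u = (1 1 ; 0 1)` […] There is a (unique) group homomorphism `SL₂(ℤ) → Corr(A)^*` mapping `u` to
`Δ_* e^θ` and `w` to `d⁻¹ e^℘`."

## How the printed theorem is matched (cohomological realisation, `d = 1`, `s = 0`)

Row g38-#1 integrates the Lefschetz module `(⋀W, h, L_ω)` (`HodgeStructureExteriorAlgebraLefschetzModule`: `IsSymplectic.hasLefschetzProperty_mul`,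
partner `dual = Λ = lefschetzDual ω g`, Weyl operator `weylOperator = weylStar ω g`) to `sl2Action ω g : SL(2, K) →* End(⋀W)` with the
abstract values `exp(a L)`, `exp(a Λ)`, `w`, `tʰ`; the four printed formulas are these values read through the tree's dictionary:
`exp(a L) = e^{aω} ∧ ·` (`exp_mul_eq_of_pow_eq_zero`, `(aω)^{g+1} = 0`) — §2; `w = weylStar = ℱ` (Beauville's own theorem `(0 −1 ; 1 0) ↦ ℱ`,
row g37-#3 `fourierTransform_eq_weylStar`) — §3; `exp(aΛ) z = Σ_k a^k Λ^k z/k! = Σ_k a^k z ⋆ ω^{g−k}/(g−k)! = a^g z ⋆ Σ_m (ω/a)^m/m! =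
a^g e^{θ/a} ⋆ z` (row g36-#9) — §4; `tʰ = t^{k−g}` on `⋀ᵏ = M_{k−g}`, `= t^{−g} tᵏ = t^{−g} t^*` (row g33-#4 `map_smul_id_apply_of_mem`) — §5.
The Lie-algebra clause is the tree's dictionary itself: `X ↦ L = θ ∧ ·`, `Y ↦ Λ = · ⋆ θ^{g−1}/(g−1)!` (row g36-#8
`IsSymplectic.lefschetzDual_apply_eq_pontryagin`), `H ↦ h = 2p − g` on `H^{2p}` (`shiftedDegree_apply_of_mem_exteriorPower`); "direct sum of
finite-dimensional representations" is automatic (`⋀W` is finite-dimensional). §6: the restriction along `SL₂(ℤ) → SL₂(K)` sends Mathlib's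
`ModularGroup.T = (1 1 ; 0 1)`, `ModularGroup.S = (0 −1 ; 1 0)` to `e^θ ∧ ·` and `ℱ` — Beauville's §2 homomorphism `u ↦ Δ_*e^θ`, `w ↦ e^℘`.
§7: every `γ ∈ SL₂(K)` acts by an element of `K[L, Λ]` (Milne's Lefschetz operators) and commutes with `Sp(W, ω)`.

## What is DEFINED and PROVED

* §1 **`sl2Action ω g`** (junk value the trivial homomorphism if `ω` is not symplectic of genus `g`), `IsSymplectic.sl2Action_eq`, `sl2Action_of_not`.
* §2 **`IsSymplectic.sl2Action_apply_of_coe_eq_upper`**: `(1 a ; 0 1)·z = e^{aω} ∧ z`.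
* §3 **`IsSymplectic.sl2Action_eq_fourierTransform_of_coe_eq_weyl`**: `(0 −1 ; 1 0)· = ℱ` (and `= weylStar ω g` without `g ≥ 1`).
* §4 `IsSymplectic.exp_smul_lefschetzDual_apply` (`exp(aΛ) z = a^g z ⋆ e^{ω/a}`, `a ≠ 0`), **`IsSymplectic.sl2Action_apply_of_coe_eq_lower`**:
  `(1 0 ; a 1)·z = a^g (z ⋆ e^{ω/a})`.
* §5 **`IsSymplectic.sl2Action_apply_of_coe_eq_diagonal`** (`diag(t, t⁻¹)·z = t^{k−g} z` on `⋀ᵏ`), **`IsSymplectic.sl2Action_apply_of_coe_eq_diagonal'`**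
  (`= t^{−g} t^* z`), `IsSymplectic.sl2Action_neg_one_apply` (`(−1)·z = (−1)^{k+g} z = ℱ(ℱ z)`).
* §6 `IsSymplectic.sl2Action_modularT`, **`IsSymplectic.sl2Action_modularS`** (`S ↦ ℱ`, `T ↦ e^θ ∧ ·`: the §2 homomorphism `SL₂(ℤ) → Aut`).
* §7 **`IsSymplectic.sl2Action_mem_adjoin`** (`ρ(γ) ∈ K[L, Λ]`), **`IsSymplectic.map_sl2Action_apply`** (`⋀f ∘ ρ(γ) = ρ(γ) ∘ ⋀f` for `⋀f ω = ω`),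
  `IsSymplectic.sl2Action_unique` (a homomorphism with `(1 a ; 0 1) ↦ e^{aω}∧`, `(1 0 ; a 1) ↦ exp(aΛ)` is `sl2Action`).

TWIN NOTICE (RULING 29 bis): nothing of the torus-forms carriers (`Geometry/Kaehler/ComplexTorusFourier…`) or of
`RepresentationTheory/AlgebraicGroups/Sl2StringRep` is imported or restated. Not here: Chow groups / the `s`-grading (`CH^p_s`), `d ≠ 1`.

## References

* [Beauville2010SL2] A. Beauville, *The action of SL₂ on abelian varieties*, J. Ramanujan Math. Soc. 25 (2010) 253–263, arXiv:0805.1541, §2,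
  §3 Theorem, §4 Theorem (and proof).
* [Lange2023AbelianVarietiesComplex] H. Lange, *Abelian Varieties over the Complex Numbers* (2023), §2.5.3 Thm. 2.5.16 (Poincaré's formula),
  §6.2.4 (6.11) (the Fourier transform on cohomology).
* [Milne1999LefschetzClasses] J. S. Milne, *Lefschetz classes on abelian varieties*, Duke Math. J. 96 (1999), §5 Thm. 5.9 (`ℚ[L, Λ]`).
* [Andre1996Motifs] Y. André, *Pour une théorie inconditionnelle des motifs*, Publ. Math. IHÉS 83 (1996), §1.2 (p. 11).
-/

noncomputable section

open scoped TensorProduct Nat MatrixGroups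

namespace Literature.AlgebraicGeometry.Motives

namespace ExteriorLefschetz

open ExteriorAlgebra Literature.Algebra.Lie

universe u v

/-! ## §1 The representation `sl2Action ω g : SL₂(K) → End(⋀W)` -/

section Def

variable {K : Type u} [Field K] [CharZero K] {W : Type v} [AddCommGroup W] [Module K W]

/-- **Beauville's representation of `SL₂(K)` on `H•(X) = ⋀W`** for a symplectic `ω` of genus `g`: the integration (row g38-#1,
`HasLefschetzProperty.sl2Rep`) of the Lefschetz `𝔰𝔩₂`-triple `(L_ω, h, Λ_ω)` of `⋀W` — `(1 a ; 0 1) ↦ exp(a L) = e^{aω} ∧ ·`,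
`(1 0 ; a 1) ↦ exp(a Λ) = a^g e^{ω/a} ⋆ ·`, `(0 −1 ; 1 0) ↦ w = ℱ`, `diag(t, t⁻¹) ↦ tʰ = t^{−g} t^*`; junk value `1` (the trivial homomorphism) if
`ω` is not symplectic of genus `g`. [cite: Beauville2010SL2, §4 Theorem] [cite: Beauville2010SL2, §3 Theorem] -/
def sl2Action (ω : ExteriorAlgebra K W) (g : ℕ) : SL(2, K) →* Module.End K (ExteriorAlgebra K W) :=
  open Classical in
  if hω : IsSymplectic ω g then
    haveI := hω.finiteDimensional_exteriorAlgebra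
    hω.hasLefschetzProperty_mul.sl2Rep (isZGrading_shiftedDegree K (fun i : ℕ ↦ ⋀[K]^i W) g)
  else 1

/-- Junk value. [cite: Beauville2010SL2, §4 Theorem] -/
theorem sl2Action_of_not {ω : ExteriorAlgebra K W} {g : ℕ} (h : ¬IsSymplectic ω g) : sl2Action ω g = 1 := by
  classical
  exact dif_neg h

variable {ω : ExteriorAlgebra K W} {g : ℕ}

/-- `sl2Action ω g` IS the abstract `sl2Rep` of the Lefschetz module `(⋀W, h, L_ω)`. [cite: Beauville2010SL2, §4 Theorem (proof: "g·z = φ(g)_* z")] -/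
theorem IsSymplectic.sl2Action_eq (hω : IsSymplectic ω g) :
    sl2Action ω g = (haveI := hω.finiteDimensional_exteriorAlgebra
      hω.hasLefschetzProperty_mul.sl2Rep (isZGrading_shiftedDegree K (fun i : ℕ ↦ ⋀[K]^i W) g)) := by
  classical
  exact dif_pos hω

end Def

section Values

variable {K : Type u} [Field K] [CharZero K] {W : Type v} [AddCommGroup W] [Module K W] {ω : ExteriorAlgebra K W} {g : ℕ}

/-! ## §2 `(1 a ; 0 1)·z = e^{aθ} z` -/

omit [CharZero K] in
/-- `(aω)^{g+1} = 0`. [cite: Beauville2010SL2, §4 Theorem] -/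
theorem IsSymplectic.smul_pow_genus_succ_eq_zero (hω : IsSymplectic ω g) (a : K) : (a • ω) ^ (g + 1) = 0 := by
  rw [smul_pow, hω.pow_genus_succ_eq_zero, smul_zero]

/-- **`(1 a ; 0 1)·z = e^{aθ} z`**: the upper unipotents act by cup product with `e^{aω} = Σ_{m≤g} (aω)^m/m!` ("`(Δ_* e^{aθ})_* z = e^{aθ} z`").
[cite: Beauville2010SL2, §4 Theorem ("(1 a ; 0 1)·z = e^{aθ}z")] -/
theorem IsSymplectic.sl2Action_apply_of_coe_eq_upper (hω : IsSymplectic ω g) (γ : SL(2, K)) {a : K}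
    (hγ : (γ : Matrix (Fin 2) (Fin 2) K) = !![1, a; 0, 1]) (z : ExteriorAlgebra K W) :
    sl2Action ω g γ z = (∑ m ∈ Finset.range (g + 1), (m ! : K)⁻¹ • (a • ω) ^ m) * z := by
  haveI := hω.finiteDimensional_exteriorAlgebra
  letI := Algebra.compHom (Module.End K (ExteriorAlgebra K W)) (algebraMap ℚ K)
  rw [hω.sl2Action_eq, hω.hasLefschetzProperty_mul.sl2Rep_apply_of_coe_eq_upper _ γ hγ, ← map_smul,
    exp_mul_eq_of_pow_eq_zero (hω.smul_pow_genus_succ_eq_zero a), LinearMap.mul_apply']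

/-- `(1 1 ; 0 1)·z = e^{θ} z` — Beauville's generator `u ↦ Δ_* e^θ`. [cite: Beauville2010SL2, §2 ("mapping u to Δ_* e^θ") and §4 Theorem] -/
theorem IsSymplectic.sl2Action_apply_of_coe_eq_upper_one (hω : IsSymplectic ω g) (γ : SL(2, K))
    (hγ : (γ : Matrix (Fin 2) (Fin 2) K) = !![1, 1; 0, 1]) (z : ExteriorAlgebra K W) :
    sl2Action ω g γ z = (∑ m ∈ Finset.range (g + 1), (m ! : K)⁻¹ • ω ^ m) * z := by
  rw [hω.sl2Action_apply_of_coe_eq_upper γ hγ, one_smul]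

/-! ## §3 `(0 −1 ; 1 0)·z = ℱ(z)` -/

/-- **`(0 −1 ; 1 0)· = w`**: the Weyl element acts by the Weyl operator `weylStar ω g` (any `g`). [cite: Beauville2010SL2, §4 Theorem]
[cite: Andre1996Motifs, §1.2 (p. 11)] -/
theorem IsSymplectic.sl2Action_eq_weylStar_of_coe_eq_weyl (hω : IsSymplectic ω g) (γ : SL(2, K))
    (hγ : (γ : Matrix (Fin 2) (Fin 2) K) = !![0, -1; 1, 0]) : sl2Action ω g γ = weylStar ω g := by
  haveI := hω.finiteDimensional_exteriorAlgebra
  rw [hω.sl2Action_eq, hω.hasLefschetzProperty_mul.sl2Rep_apply_of_coe_eq_weyl _ γ hγ, hω.weylStar_eq]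

/-- **BEAUVILLE'S THEOREM `(0 −1 ; 1 0)·z = ℱ(z)`**: the Weyl element of `SL₂` acts on `H•(X)` by the Fourier transform `ℱ = (e^℘)_*`
(`g ≥ 1`; row g37-#3 `ℱ = w`). [cite: Beauville2010SL2, §4 Theorem ("(0 −1 ; 1 0)·z = ℱ(z)")] -/
theorem IsSymplectic.sl2Action_eq_fourierTransform_of_coe_eq_weyl (hω : IsSymplectic ω g) (hg : 0 < g) (γ : SL(2, K))
    (hγ : (γ : Matrix (Fin 2) (Fin 2) K) = !![0, -1; 1, 0]) : sl2Action ω g γ = fourierTransform ω g := by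
  rw [hω.sl2Action_eq_weylStar_of_coe_eq_weyl γ hγ, hω.fourierTransform_eq_weylStar hg]

/-! ## §4 `(1 0 ; a 1)·z = a^g e^{θ/a} ⋆ z` -/

/-- **`exp(aΛ) z = a^g · z ⋆ e^{ω/a}`** for `a ≠ 0`, `e^{ω/a} = Σ_{m≤g} (a⁻¹ω)^m/m!`: `exp(aΛ) z = Σ_k a^k Λ^k z/k! = Σ_k a^k z ⋆ ω^{g−k}/(g−k)!`
(row g36-#9 `x ⋆ ω^{[m]} = Λ^{g−m} x/(g−m)!`). [cite: Beauville2010SL2, §4 Theorem (proof, "(e^{δ^*θ/a})_* z = e^{θ/a} ⋆ z")]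
[cite: Lange2023AbelianVarietiesComplex, §2.5.3 Thm. 2.5.16 (Poincaré's formula)] -/
theorem IsSymplectic.exp_smul_lefschetzDual_apply (hω : IsSymplectic ω g) {a : K} (ha : a ≠ 0) (z : ExteriorAlgebra K W) :
    letI := Algebra.compHom (Module.End K (ExteriorAlgebra K W)) (algebraMap ℚ K)
    IsNilpotent.exp (a • lefschetzDual ω g) z =
      a ^ g • hω.pontryagin z (∑ m ∈ Finset.range (g + 1), (m ! : K)⁻¹ • (a⁻¹ • ω) ^ m) := by
  letI := Algebra.compHom (Module.End K (ExteriorAlgebra K W)) (algebraMap ℚ K)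
  have hnil : (a • lefschetzDual ω g) ^ (g + 1) = 0 := by rw [smul_pow, hω.lefschetzDual_pow_genus_succ, smul_zero]
  rw [IsNilpotent.exp_eq_sum hnil, LinearMap.sum_apply, map_sum, Finset.smul_sum,
    ← Finset.sum_range_reflect (fun m ↦ a ^ g • hω.pontryagin z ((m ! : K)⁻¹ • (a⁻¹ • ω) ^ m)) (g + 1)]
  refine Finset.sum_congr rfl fun k hk ↦ ?_
  rw [Finset.mem_range] at hk
  have hkg : k ≤ g := Nat.lt_succ_iff.mp hk
  have hP := hω.pontryagin_inv_factorial_smul_pow_eq (show k + (g - k) = g by omega) z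
  rw [Algebra.compHom_smul_def, map_inv₀, map_natCast, LinearMap.smul_apply, smul_pow a (lefschetzDual ω g) k, LinearMap.smul_apply,
    Nat.add_sub_cancel, smul_pow a⁻¹ ω (g - k), smul_comm (((g - k) ! : ℕ) : K)⁻¹ (a⁻¹ ^ (g - k)) (ω ^ (g - k)), map_smul, hP,
    smul_smul, smul_smul, smul_smul]
  congr 1
  rw [inv_pow, ← pow_sub₀ _ ha (Nat.sub_le g k), Nat.sub_sub_self hkg, mul_comm]

/-- **`(1 0 ; a 1)·z = a^g e^{θ/a} ⋆ z`** (`a ≠ 0`, `g ≥ 1`; `d = 1`): the lower unipotents act through the Pontryagin product with the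
rescaled exponential of the polarization. [cite: Beauville2010SL2, §4 Theorem ("(1 0 ; a 1)·z = d⁻¹aᵍe^{θ/a} ⋆ z")] -/
theorem IsSymplectic.sl2Action_apply_of_coe_eq_lower (hω : IsSymplectic ω g) (hg : 0 < g) (γ : SL(2, K)) {a : K} (ha : a ≠ 0)
    (hγ : (γ : Matrix (Fin 2) (Fin 2) K) = !![1, 0; a, 1]) (z : ExteriorAlgebra K W) :
    sl2Action ω g γ z = a ^ g • hω.pontryagin z (∑ m ∈ Finset.range (g + 1), (m ! : K)⁻¹ • (a⁻¹ • ω) ^ m) := by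
  haveI := hω.finiteDimensional_exteriorAlgebra
  letI := Algebra.compHom (Module.End K (ExteriorAlgebra K W)) (algebraMap ℚ K)
  rw [hω.sl2Action_eq, hω.hasLefschetzProperty_mul.sl2Rep_apply_of_coe_eq_lower _ γ hγ, hω.dual_eq_lefschetzDual hg,
    hω.exp_smul_lefschetzDual_apply ha]

/-- `(1 0 ; 1 1)·z = z ⋆ e^{θ}` — Beauville's `v = uwu ↦ e^{δ^*θ}`, `(e^{δ^*θ})_* z = e^θ ⋆ z`. [cite: Beauville2010SL2, §3 Theorem (proof, "φ(v) = e^{δ^*θ}") and §4 Theorem] -/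
theorem IsSymplectic.sl2Action_apply_of_coe_eq_lower_one (hω : IsSymplectic ω g) (hg : 0 < g) (γ : SL(2, K))
    (hγ : (γ : Matrix (Fin 2) (Fin 2) K) = !![1, 0; 1, 1]) (z : ExteriorAlgebra K W) :
    sl2Action ω g γ z = hω.pontryagin z (∑ m ∈ Finset.range (g + 1), (m ! : K)⁻¹ • ω ^ m) := by
  rw [hω.sl2Action_apply_of_coe_eq_lower hg γ (one_ne_zero' K) hγ, inv_one, one_pow, one_smul]
  simp only [one_smul]

/-! ## §5 `(n 0 ; 0 n⁻¹)·z = n^{−g} n^* z` -/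

/-- **`diag(t, t⁻¹)·z = t^{k−g} z` on `⋀ᵏW = Hᵏ(X)`** (`Hᵏ = M_{k−g}` for the grading `h`): the torus acts by the weights.
[cite: Beauville2010SL2, §4 Theorem ("(n 0 ; 0 n⁻¹)·z = n^{−g} n^*z", "Hz = (2p−g−s)z")] -/
theorem IsSymplectic.sl2Action_apply_of_coe_eq_diagonal (hω : IsSymplectic ω g) (γ : SL(2, K)) {t : K}
    (hγ : (γ : Matrix (Fin 2) (Fin 2) K) = !![t, 0; 0, t⁻¹]) {k : ℕ} {z : ExteriorAlgebra K W} (hz : z ∈ ⋀[K]^k W) :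
    sl2Action ω g γ z = (t ^ ((k : ℤ) - g)) • z := by
  haveI := hω.finiteDimensional_exteriorAlgebra
  have hz' : z ∈ degreeSpace (shiftedDegree K (fun i : ℕ ↦ ⋀[K]^i W) g) ((k : ℤ) - g) := by
    rw [degreeSpace_shiftedDegree_eq_exteriorPower g ((k : ℤ) - g) k (by omega)]; exact hz
  rw [hω.sl2Action_eq, hω.hasLefschetzProperty_mul.sl2Rep_apply_of_coe_eq_diagonal _ γ hγ,
    (isZGrading_shiftedDegree K (fun i : ℕ ↦ ⋀[K]^i W) g).torus_apply_of_mem t hz']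

/-- **`(n 0 ; 0 n⁻¹)·z = n^{−g} n^* z`** with `n^* = ⋀(n · id)` the pull-back by the isogeny `n_X` (`= nᵏ` on `Hᵏ`, row g33-#4), `n ≠ 0`.
[cite: Beauville2010SL2, §4 Theorem ("(n 0 ; 0 n⁻¹)·z = n^{−g} n^*z")] [cite: Beauville2010SL2, §3 Theorem ("φ(n 0 ; 0 n⁻¹) = n^{−g} Γ'_n")] -/
theorem IsSymplectic.sl2Action_apply_of_coe_eq_diagonal' (hω : IsSymplectic ω g) (γ : SL(2, K)) {t : K} (ht : t ≠ 0)
    (hγ : (γ : Matrix (Fin 2) (Fin 2) K) = !![t, 0; 0, t⁻¹]) (z : ExteriorAlgebra K W) :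
    sl2Action ω g γ z = (t ^ (-(g : ℤ))) • ExteriorAlgebra.map (t • (LinearMap.id : W →ₗ[K] W)) z := by
  induction z using DirectSum.Decomposition.inductionOn (fun i : ℕ ↦ ⋀[K]^i W) with
  | zero => rw [map_zero, map_zero, smul_zero]
  | add x y hx hy => rw [map_add, map_add, hx, hy, smul_add]
  | @homogeneous k x =>
    rw [hω.sl2Action_apply_of_coe_eq_diagonal γ hγ x.2, map_smul_id_apply_of_mem t x.2, smul_smul, ← zpow_natCast, ← zpow_add₀ ht,
      neg_add_eq_sub]

/-- **`(−1)·z = (−1)^{k+g} z = ℱ(ℱ z)` on `Hᵏ`**: the centre of `SL₂` acts by `(−1)^{−g}(−1)^*` (Mukai–Beauville `ℱ² = (−1)^g (−1)^*`).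
[cite: Beauville2010SL2, §4 Theorem] [cite: Beauville2010SL2, §2 ("z = w̃² acting as (−1_A)^*[−g]")] -/
theorem IsSymplectic.sl2Action_neg_one_apply (hω : IsSymplectic ω g) {k : ℕ} {z : ExteriorAlgebra K W} (hz : z ∈ ⋀[K]^k W) :
    sl2Action ω g (-1) z = ((-1 : K) ^ (k + g)) • z := by
  have hγ : ((-1 : SL(2, K)) : Matrix (Fin 2) (Fin 2) K) = !![-1, 0; 0, (-1)⁻¹] := by
    rw [Matrix.SpecialLinearGroup.coe_neg, Matrix.SpecialLinearGroup.coe_one, inv_neg, inv_one]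
    ext i j; fin_cases i <;> fin_cases j <;> simp
  rw [hω.sl2Action_apply_of_coe_eq_diagonal (-1) hγ hz]
  congr 1
  rw [show ((k : ℤ) - g) = (k + g : ℕ) - 2 * (g : ℤ) by push_cast; ring, zpow_sub₀ (neg_ne_zero.2 one_ne_zero), zpow_natCast, zpow_mul,
    zpow_ofNat, neg_one_sq, one_zpow, div_one]

/-- `(−1)· = ℱ ∘ ℱ` (`g ≥ 1`). [cite: Beauville2010SL2, §2 and §4 Theorem] -/
theorem IsSymplectic.sl2Action_neg_one (hω : IsSymplectic ω g) (hg : 0 < g) :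
    sl2Action ω g (-1) = fourierTransform ω g * fourierTransform ω g := by
  haveI := hω.finiteDimensional_exteriorAlgebra
  rw [hω.sl2Action_eq, hω.hasLefschetzProperty_mul.sl2Rep_neg_one, ← hω.weylStar_eq, hω.fourierTransform_eq_weylStar hg]

/-! ## §6 The restriction to `SL₂(ℤ)`: `T ↦ e^θ ∧ ·`, `S ↦ ℱ` (Beauville §2) -/

/-- **`T = (1 1 ; 0 1) ∈ SL₂(ℤ)` acts by `e^θ ∧ ·`** (Beauville's `u ↦ Δ_* e^θ`; Mathlib's `ModularGroup.T` through `SL₂(ℤ) → SL₂(K)`).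
[cite: Beauville2010SL2, §2 ("There is a (unique) group homomorphism SL₂(ℤ) → Corr(A)^* mapping u to Δ_*e^θ and w to d⁻¹e^℘")] -/
theorem IsSymplectic.sl2Action_modularT (hω : IsSymplectic ω g) (z : ExteriorAlgebra K W) :
    sl2Action ω g (ModularGroup.T : SL(2, K)) z = (∑ m ∈ Finset.range (g + 1), (m ! : K)⁻¹ • ω ^ m) * z :=
  hω.sl2Action_apply_of_coe_eq_upper_one _ (by
    rw [Matrix.SpecialLinearGroup.coe_matrix_coe, ModularGroup.coe_T]
    ext i j; fin_cases i <;> fin_cases j <;> simp) z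

/-- **`S = (0 −1 ; 1 0) ∈ SL₂(ℤ)` acts by the Fourier transform `ℱ`** (Beauville's `w ↦ d⁻¹ e^℘`; Mathlib's `ModularGroup.S`; `g ≥ 1`).
[cite: Beauville2010SL2, §2 and §4 Theorem] -/
theorem IsSymplectic.sl2Action_modularS (hω : IsSymplectic ω g) (hg : 0 < g) :
    sl2Action ω g (ModularGroup.S : SL(2, K)) = fourierTransform ω g :=
  hω.sl2Action_eq_fourierTransform_of_coe_eq_weyl hg _ (by
    rw [Matrix.SpecialLinearGroup.coe_matrix_coe, ModularGroup.coe_S]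
    ext i j; fin_cases i <;> fin_cases j <;> simp)

/-! ## §7 `SL₂(K)` acts by Lefschetz operators: `ρ(γ) ∈ K[L, Λ]`, `Sp(ω)`-equivariance, uniqueness -/

/-- **Every `γ ∈ SL₂(K)` acts by an element of `K[L, Λ]`** (Milne: "all elements of the `ℚ`-algebra `ℚ[L, Λ]` are Lefschetz"; `g ≥ 1`).
[cite: Milne1999LefschetzClasses, §5 Thm. 5.9 (proof)] [cite: Beauville2010SL2, §4 Theorem] -/
theorem IsSymplectic.sl2Action_mem_adjoin (hω : IsSymplectic ω g) (hg : 0 < g) (γ : SL(2, K)) :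
    sl2Action ω g γ ∈ Algebra.adjoin K ({LinearMap.mul K (ExteriorAlgebra K W) ω, lefschetzDual ω g} : Set (Module.End K (ExteriorAlgebra K W))) := by
  haveI := hω.finiteDimensional_exteriorAlgebra
  rw [hω.sl2Action_eq, ← hω.dual_eq_lefschetzDual hg]
  exact hω.hasLefschetzProperty_mul.sl2Rep_mem_adjoin_pair_dual _ γ

/-- **`Sp(W, ω)`-EQUIVARIANCE: `⋀f (γ·z) = γ·(⋀f z)`** for every `f` with `⋀f ω = ω` and every `γ ∈ SL₂(K)` (`⋀f` commutes with `L` and `Λ`,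
hence with `K[L, Λ] ∋ ρ(γ)`). [cite: Milne1999LefschetzClasses, §5 Thm. 5.9 (proof, p. 665)] [cite: Beauville2010SL2, §4 Theorem] -/
theorem IsSymplectic.map_sl2Action_apply (hω : IsSymplectic ω g) (f : W →ₗ[K] W) (hf : ExteriorAlgebra.map f ω = ω)
    (γ : SL(2, K)) (z : ExteriorAlgebra K W) : ExteriorAlgebra.map f (sl2Action ω g γ z) = sl2Action ω g γ (ExteriorAlgebra.map f z) := by
  haveI := hω.finiteDimensional_exteriorAlgebra
  set L := hω.hasLefschetzProperty_mul
  set hgr := isZGrading_shiftedDegree K (fun i : ℕ ↦ ⋀[K]^i W) g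
  have hdual : Commute (ExteriorAlgebra.map f).toLinearMap (L.dual hgr) :=
    HasLefschetzProperty.commute_of_mem_adjoin_pair (commute_map_mul f hf)
      (L.commute_lefschetzInvolution hgr (commute_map_shiftedDegree f g) (commute_map_mul f hf)) (L.dual_mem_adjoin_lefschetzInvolution hgr)
  have h1 : Commute (ExteriorAlgebra.map f).toLinearMap (sl2Action ω g γ) := by
    rw [hω.sl2Action_eq]
    exact HasLefschetzProperty.commute_of_mem_adjoin_pair (commute_map_mul f hf) hdual (L.sl2Rep_mem_adjoin_pair_dual hgr γ)
  have h2 := LinearMap.congr_fun h1.eq z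
  rwa [Module.End.mul_apply, Module.End.mul_apply, AlgHom.toLinearMap_apply, AlgHom.toLinearMap_apply] at h2

/-- **UNIQUENESS**: a homomorphism `SL₂(K) → End(⋀W)` with `(1 a ; 0 1) ↦ e^{aω} ∧ ·` and `(1 0 ; a 1) ↦ exp(aΛ)` IS `sl2Action ω g`
(`g ≥ 1`; Beauville's "(unique)"). [cite: Beauville2010SL2, §3 Proposition ("(unique) morphism") and §2 ("(unique) group homomorphism")] -/
theorem IsSymplectic.sl2Action_unique (hω : IsSymplectic ω g) (hg : 0 < g) (ρ : SL(2, K) →* Module.End K (ExteriorAlgebra K W))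
    (hupper : ∀ (γ : SL(2, K)) (a : K), (γ : Matrix (Fin 2) (Fin 2) K) = !![1, a; 0, 1] →
      ρ γ = LinearMap.mul K (ExteriorAlgebra K W) (∑ m ∈ Finset.range (g + 1), (m ! : K)⁻¹ • (a • ω) ^ m))
    (hlower : ∀ (γ : SL(2, K)) (a : K), (γ : Matrix (Fin 2) (Fin 2) K) = !![1, 0; a, 1] →
      letI := Algebra.compHom (Module.End K (ExteriorAlgebra K W)) (algebraMap ℚ K); ρ γ = IsNilpotent.exp (a • lefschetzDual ω g)) :
    ρ = sl2Action ω g := by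
  haveI := hω.finiteDimensional_exteriorAlgebra
  letI := Algebra.compHom (Module.End K (ExteriorAlgebra K W)) (algebraMap ℚ K)
  rw [hω.sl2Action_eq]
  refine hω.hasLefschetzProperty_mul.sl2Rep_unique _ ρ (fun γ a hγ ↦ ?_) (fun γ a hγ ↦ ?_)
  · rw [hupper γ a hγ, ← map_smul, exp_mul_eq_of_pow_eq_zero (hω.smul_pow_genus_succ_eq_zero a)]
  · rw [hlower γ a hγ, hω.dual_eq_lefschetzDual hg]

end Values

end ExteriorLefschetz

end Literature.AlgebraicGeometry.Motives
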